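import Mathlib
import Summits.Ventures.HodgeRepro.OcticCMPointWitness

/-!
# OcticCMPointWeil — `B = A_Φ × A_{σΦ}` is of Weil type relative to `F = ℚ(ζ₅)` (the `(2,2,2,2)` multiplicities)

Blind re-derivation cell `pub-hodge-repro`, seat night-2 (gen 0).  Target tree path
`lean/Summits/Ventures/HodgeRepro/OcticCMPointWeil.lean`.  Continues `OcticCMPointWitness.lean`.

ROUTE-B §9.32 (b) (merged in ROUTE.md v2.34 §3.4) reads the exceptional classes of the octic point as QUARTIC WEIL
CLASSES: with `F = ℚ(ζ₅) ⊂ E` and `η : F → E × E = End⁰(B)`, `e ↦ (e, τ(e))`, `τ = (ζ₅ ↦ ζ₅²)`, «the `(1,0)`-multiplicities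
are `(2, 1, 1, 0)` on `A_Φ` and `(1, 2, 0, 1)` on `A_{σΦ}` for `j = 1, 2, 3, 4` — NEITHER factor is of Weil type relative
to `F` … — but their `η`-sum is `(2, 2, 2, 2)`: `(B, η)` IS of Weil type relative to the quartic Galois CM field `F`
(`e = 4`, `d = 4`, `n = 4`, `dim B = 8 = 2n`)» — Moonen–Zarhin's printed criterion (*Weil classes on abelian varieties*,
J. reine angew. Math. 496 (1998), paper:arxiv-alg-geom_9612017 p0001:L93–97, VERBATIM: «Criterion. If `n_σ = n_{σ′}`
for all `σ ∈ Σ_F` then `W_F` consists entirely of Hodge classes; if `n_σ ≠ n_{σ′}` for some `σ ∈ Σ_F` then the zero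
class is the only Hodge class in `W_F`» — `σ′` the complex conjugate of `σ`, `n_σ` «the multiplicity of `σ` on the
tangent space», p0001:L78–79) then makes the `F`-line `W_F(B) = ∧⁴_F H¹(B, ℚ)` a line of Hodge classes of type
`(2,2)` — the object closer C7 is asked about at this point: the twisted sums are constant `(2, 2, 2, 2)`, so in
particular equal on every conjugate pair `{j, −j}`.

ON THE KERNEL (all by `decide` on the model of `OcticCMPointWitness.lean`): the fibre counts
`|{ι ∈ Φ : ι(ζ₅) = ζ₅^j}| = (2, 1, 1, 0)` and `|{ι ∈ σΦ : …}| = (1, 2, 0, 1)` for `j = 1, 2, 3, 4`, and the twisted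
sums `fibre_Φ(j) + fibre_{σΦ}(3j) = 2` for every `j` (the twist `j ↦ 3j` is `τ^{-1}`, `τ(ζ₅) = ζ₅²`, `2 · 3 ≡ 1 mod 5`):
`multiplicities_phi`, `multiplicities_sigma_phi`, `weil_type_sum`.  Nothing here says anything about the status
of the Hodge conjecture for CM abelian varieties, which is NOT proved.
-/

set_option autoImplicit false

namespace Summit.Ventures.HodgeRepro.OcticCMPoint

open Finset

/-- The `F`-fibre count of a CM type at `j ↔ k + 1`: the number of embeddings in `P` restricting to `ζ₅ ↦ ζ₅^{k+1}`. -/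
def fibreCount (P : Finset X) (k : Fin 4) : ℕ := (P.filter fun x => x.1 = k).card

/-- The `(1,0)`-multiplicities of `A_Φ` on the four `F`-isotypic components: `(2, 1, 1, 0)`. -/
theorem multiplicities_phi :
    fibreCount Φ 0 = 2 ∧ fibreCount Φ 1 = 1 ∧ fibreCount Φ 2 = 1 ∧ fibreCount Φ 3 = 0 := by decide

/-- The `(1,0)`-multiplicities of `A_{σΦ}`: `(1, 2, 0, 1)`. -/
theorem multiplicities_sigma_phi :
    fibreCount (Φ.image (act σ)) 0 = 1 ∧ fibreCount (Φ.image (act σ)) 1 = 2 ∧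
      fibreCount (Φ.image (act σ)) 2 = 0 ∧ fibreCount (Φ.image (act σ)) 3 = 1 := by decide

/-- The twist `j ↦ 3j` on the index `k ↔ j = k + 1`: `τ^{-1}` for `τ(ζ₅) = ζ₅²` (`jmul 2 k`, since `3 ↔ k = 2`). -/
def twist3 (k : Fin 4) : Fin 4 := jmul 2 k

/-- **`(B, η)` is of Weil type relative to `F = ℚ(ζ₅)`**: the twisted multiplicity sums are `(2, 2, 2, 2)` — the
hypothesis of Moonen–Zarhin's criterion for `W_F(B)` to consist of Hodge classes. -/
theorem weil_type_sum : ∀ k : Fin 4, fibreCount Φ k + fibreCount (Φ.image (act σ)) (twist3 k) = 2 := by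
  decide

/-- The conjugation `j ↦ −j = 4j` on the index (`jmul 3 k`): the twisted sums agree on every conjugate pair — the
hypothesis `n_σ = n_{σ′}` of Moonen–Zarhin's Criterion for `(B, η)`. -/
theorem weil_type_conj : ∀ k : Fin 4,
    fibreCount Φ k + fibreCount (Φ.image (act σ)) (twist3 k) =
      fibreCount Φ (jmul 3 k) + fibreCount (Φ.image (act σ)) (twist3 (jmul 3 k)) := by
  decide

/-- Neither factor is of Weil type relative to `F` on its own: the multiplicities `(2,1,1,0)` of `Φ` fail
`n_σ = n_{σ′}` on the conjugate pair `{1, 4}` (`2 ≠ 0`), those `(1,2,0,1)` of `σΦ` on the pair `{2, 3}` (`2 ≠ 0`). -/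
theorem factors_not_weil_type :
    fibreCount Φ 0 ≠ fibreCount Φ (jmul 3 0) ∧
      fibreCount (Φ.image (act σ)) 1 ≠ fibreCount (Φ.image (act σ)) (jmul 3 1) := by
  decide

/-! ### The four exceptional `4`-sets are exactly the four weight vectors of `W_F(B)` (ROUTE-B §9.32 (a)/(b)) -/

/-- A `4`-set of `X ⊔ X` balanced under all sixteen Galois elements (`|gD ∩ Φ_B| = 2`). -/
def balanced4 (D : Finset XB) : Bool := decide (∀ g : G, ((D.image (actB g)) ∩ ΦB).card = 2)

/-- A balanced `2`-set — a Pohlmann pair (`|gD ∩ Φ_B| = 1`). -/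
def balanced2 (D : Finset XB) : Bool := decide (∀ g : G, ((D.image (actB g)) ∩ ΦB).card = 1)

/-- `D` meets both factors. -/
def mixing (D : Finset XB) : Bool := decide ((∃ p ∈ D, p.1 = false) ∧ ∃ p ∈ D, p.1 = true)

/-- `D` is a union of two Pohlmann pairs. -/
def unionOfPairs (D : Finset XB) : Bool :=
  decide (∃ P ∈ D.powersetCard 2, balanced2 P = true ∧ balanced2 (D \ P) = true)

/-- The exceptional mixing `4`-sets: balanced, meeting both factors, not a union of two Pohlmann pairs. -/
def exceptional4 : Finset (Finset XB) :=
  ((univ : Finset XB).powersetCard 4).filter fun D =>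
    balanced4 D = true ∧ mixing D = true ∧ unionOfPairs D = false

/-- The weight vector of `W_F(B) ⊗ ℂ` at the `F`-embedding `j ↔ k + 1`: the `F`-isotypic fibre `{ι_{j,±}}` of
`X → Hom(F, ℂ)` on the first factor and the fibre `{ι_{3j,±}}` on the second (ROUTE-B §9.32 (b): «the F-isotypic
component of the embedding j is the fibre {ι_{j,+}, ι_{j,−}} … on the first factor and the fibre {ι_{3j,±}} on the
second»). -/
def weilSet (k : Fin 4) : Finset XB :=
  (((univ : Finset X).filter fun x => x.1 = k).image fun x => ((false : Bool), x)) ∪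
    (((univ : Finset X).filter fun x => x.1 = twist3 k).image fun x => ((true : Bool), x))

set_option maxRecDepth 100000 in
/-- **Exactly four exceptional mixing `4`-sets** (ROUTE-B §9.32 (a): «there are exactly 4 such 4-sets»), by a
kernel enumeration of the `1820` four-subsets of `X ⊔ X`. -/
theorem exceptional4_card : exceptional4.card = 4 := by decide +kernel

set_option maxRecDepth 100000 in
/-- **They are exactly the four weight vectors of `W_F(B)`** (ROUTE-B §9.32 (b): «the four exceptional 4-sets of (a)
are exactly the four weight vectors fibre_Φ(j) ⊔ fibre_{σΦ}(3j), j = 1, …, 4, of W_F(B) ⊗ ℂ»), `Δ` being the one at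
`j = 1`. -/
theorem exceptional4_eq_weilSets : exceptional4 = (univ : Finset (Fin 4)).image weilSet := by decide +kernel

/-- `Δ` is the weight vector at `j = 1`. -/
theorem delta_eq_weilSet_zero : Δ = weilSet 0 := by decide

end Summit.Ventures.HodgeRepro.OcticCMPoint
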